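import Summits.Ventures.PercRepro.Night2LocalSeries

/-!
# PercRepro — THEOREM E in the kernel: the pair count and the local form at `|E ∖ G| = q` (night-2, gen 8)

Continues `Night2LocalSeries.lean`.  **`two_mul_card_seriesPairs_le`** ((k3) of `proofs/NIGHT-2-local.md` §17(k)):
the series pairs of a set `S` of rank `u+1` with `κ₀` coloops number at most `(u+2−κ₀)(u+1−κ₀)/2` — a maximal
no-series subset `R` of the non-coloops is a transversal, `X := nonColoops ∖ R` has `|X| ≤ u+1−κ₀`
(`indep_coloops_union`), and `P ↦ P ∩ X` injects the pairs into the 2- and 1-subsets of `X`.  The members carrying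
layer-2 weight at a shadow set are series pairs (`sdiff_mem_seriesPairs`), so (k3) holds (`two_mul_card_ex2_le`),
and with `localShadowHall_dq_of_pairs`:

**`localShadowHall_dq`** — THEOREM E: at a rank-`(q+1)` flat `G` with `|E ∖ G| = q` whose restriction has `k`
coloops with `2k ≤ (q+1−k)²`, the local form (LI_G) holds.
-/

namespace PercRepro.Shadow

open Finset PerFlat ThmH

variable {α : Type*} [DecidableEq α] {M : Matroid α} [M.Finite]

/-! ## The pair count -/

open scoped Classical in
/-- The series pairs of `S`, as 2-subsets. -/
noncomputable def seriesPairs (M : Matroid α) [M.Finite] (S : Finset α) (u : ℕ) : Finset (Finset α) :=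
  (Finset.powersetCard 2 S).filter (fun P => ∀ x ∈ P, ∀ y ∈ P, x ≠ y → SeriesPair M S u x y)

open scoped Classical in
/-- **The series pairs of `S` number at most `(q+2−κ₀)(q+1−κ₀)/2`**, `κ₀` the number of coloops of `S` of rank
`q + 1`: `2 · #seriesPairs ≤ (q+2−κ₀)(q+1−κ₀)`. -/
theorem two_mul_card_seriesPairs_le {S : Finset α} (hS : S ⊆ gr M) {u : ℕ} (hSr : rkN M S = u + 1) :
    2 * (seriesPairs M S u).card ≤ (u + 2 - (coloops M S).card) * (u + 1 - (coloops M S).card) := by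
  obtain ⟨R, hRN, hRno, hmate, huniq⟩ := exists_transversal (M := M) S u
  set X := nonColoops M S \ R with hXdef
  have hXN : X ⊆ nonColoops M S := Finset.sdiff_subset
  have hXS : X ⊆ S := hXN.trans Finset.sdiff_subset
  -- |coloops ∪ X| ≤ u + 1
  have hind := indep_coloops_union hS hSr hXS (fun x hx => by
    obtain ⟨r, hr, hp⟩ := hmate x (hXN hx) (Finset.mem_sdiff.1 hx).2
    exact ⟨r, (hRN hr |> fun h => (Finset.mem_sdiff.1 h).1), fun hrX => (Finset.mem_sdiff.1 hrX).2 hr, hp⟩)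
  have hcard : (coloops M S).card + X.card ≤ u + 1 := by
    have h1 := hind.encard_le_eRk_of_subset (by exact_mod_cast (Finset.union_subset (Finset.filter_subset _ _) hXS) :
      ((coloops M S ∪ X : Finset α) : Set α) ⊆ (S : Set α))
    rw [Set.encard_coe_eq_coe_finsetCard, eRk_eq_rkN, hSr] at h1
    have hdisj : Disjoint (coloops M S) X := by
      rw [Finset.disjoint_left]
      intro c hc hcX
      exact (Finset.mem_sdiff.1 (hXN hcX)).2 hc
    have h2 : (coloops M S ∪ X).card ≤ u + 1 := by exact_mod_cast h1
    rwa [Finset.card_union_of_disjoint hdisj] at h2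
  -- every series pair meets R in at most one element and lies in nonColoops
  have hpairX : ∀ P ∈ seriesPairs M S u, P ∩ X ∈ Finset.powersetCard 2 X ∪ Finset.powersetCard 1 X := by
    intro P hP
    have hP : P ∈ Finset.powersetCard 2 S ∧ ∀ x ∈ P, ∀ y ∈ P, x ≠ y → SeriesPair M S u x y := by
      unfold seriesPairs at hP; exact Finset.mem_filter.1 hP
    rw [Finset.mem_powersetCard] at hP
    obtain ⟨⟨hPS, hP2⟩, hser⟩ := hP
    obtain ⟨x, y, hxy, rfl⟩ := Finset.card_eq_two.1 hP2
    have hxyS : SeriesPair M S u x y := hser x (by simp) y (by simp) hxy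
    have hxN : x ∈ nonColoops M S := mem_nonColoops_of_seriesPair hS hSr hxyS
    have hyN : y ∈ nonColoops M S := mem_nonColoops_of_seriesPair hS hSr hxyS.symm
    have hnotboth : ¬ (x ∈ R ∧ y ∈ R) := fun h => hRno x h.1 y h.2 hxyS
    rw [Finset.mem_union, Finset.mem_powersetCard, Finset.mem_powersetCard]
    by_cases hxR : x ∈ R
    · have hyR : y ∉ R := fun h => hnotboth ⟨hxR, h⟩
      have : ({x, y} : Finset α) ∩ X = {y} := by
        ext a; simp only [Finset.mem_inter, Finset.mem_insert, Finset.mem_singleton, hXdef, Finset.mem_sdiff]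
        constructor
        · rintro ⟨rfl | rfl, hN, hR⟩
          · exact absurd hxR hR
          · rfl
        · rintro rfl; exact ⟨Or.inr rfl, hyN, hyR⟩
      right; rw [this]
      refine ⟨Finset.singleton_subset_iff.2 (Finset.mem_sdiff.2 ⟨hyN, hyR⟩), Finset.card_singleton _⟩
    · by_cases hyR : y ∈ R
      · have : ({x, y} : Finset α) ∩ X = {x} := by
          ext a; simp only [Finset.mem_inter, Finset.mem_insert, Finset.mem_singleton, hXdef, Finset.mem_sdiff]
          constructor
          · rintro ⟨rfl | rfl, hN, hR⟩
            · rfl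
            · exact absurd hyR hR
          · rintro rfl; exact ⟨Or.inl rfl, hxN, hxR⟩
        right; rw [this]
        exact ⟨Finset.singleton_subset_iff.2 (Finset.mem_sdiff.2 ⟨hxN, hxR⟩), Finset.card_singleton _⟩
      · have : ({x, y} : Finset α) ∩ X = {x, y} := by
          apply Finset.inter_eq_left.2
          intro a ha
          rw [Finset.mem_insert, Finset.mem_singleton] at ha
          rcases ha with rfl | rfl
          · exact Finset.mem_sdiff.2 ⟨hxN, hxR⟩
          · exact Finset.mem_sdiff.2 ⟨hyN, hyR⟩
        left; rw [this]
        exact ⟨by rw [← this]; exact Finset.inter_subset_right, hP2⟩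
  -- the map P ↦ P ∩ X is injective on the series pairs
  have hinj : Set.InjOn (fun P : Finset α => P ∩ X) ((seriesPairs M S u : Finset (Finset α)) : Set (Finset α)) := by
    intro P hP P' hP' hPP'
    rw [Finset.mem_coe] at hP hP'
    have hPX := hpairX P hP; have hP'X := hpairX P' hP'
    have heq : P ∩ X = P' ∩ X := hPP'
    have hP : P ∈ Finset.powersetCard 2 S ∧ ∀ x ∈ P, ∀ y ∈ P, x ≠ y → SeriesPair M S u x y := by
      unfold seriesPairs at hP; exact Finset.mem_filter.1 hP
    have hP' : P' ∈ Finset.powersetCard 2 S ∧ ∀ x ∈ P', ∀ y ∈ P', x ≠ y → SeriesPair M S u x y := by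
      unfold seriesPairs at hP'; exact Finset.mem_filter.1 hP'
    rw [Finset.mem_powersetCard] at hP hP'
    obtain ⟨⟨hPS, hP2⟩, hser⟩ := hP
    obtain ⟨⟨hP'S, hP'2⟩, hser'⟩ := hP'
    -- elements of P outside X are in R (they are non-coloops)
    have hout : ∀ Q, Q ⊆ S → Q.card = 2 → (∀ x ∈ Q, ∀ y ∈ Q, x ≠ y → SeriesPair M S u x y) →
        ∀ a ∈ Q, a ∉ X → a ∈ R := by
      intro Q hQS hQ2 hQser a ha haX
      obtain ⟨x, y, hxy, rfl⟩ := Finset.card_eq_two.1 hQ2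
      have hN : a ∈ nonColoops M S := by
        rw [Finset.mem_insert, Finset.mem_singleton] at ha
        rcases ha with rfl | rfl
        · exact mem_nonColoops_of_seriesPair hS hSr (hQser a (by simp) y (by simp) hxy)
        · exact mem_nonColoops_of_seriesPair hS hSr (hQser a (by simp) x (by simp) hxy.symm)
      by_contra haR
      exact haX (Finset.mem_sdiff.2 ⟨hN, haR⟩)
    -- case analysis on |P ∩ X|
    rw [Finset.mem_union, Finset.mem_powersetCard, Finset.mem_powersetCard] at hPX hP'X
    rcases hPX with ⟨hsub, hc⟩ | ⟨hsub, hc⟩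
    · -- P ⊆ X, hence P' ∩ X has 2 elements, so P' ⊆ X
      have hPin : P ∩ X = P := by
        apply Finset.inter_eq_left.2
        intro a ha
        by_contra haX
        have : (P ∩ X).card < P.card := Finset.card_lt_card ⟨Finset.inter_subset_left, fun h => haX (Finset.mem_inter.1 (h ha)).2⟩
        omega
      have hP'in : P' ∩ X = P' := by
        apply Finset.inter_eq_left.2
        intro a ha
        by_contra haX
        have : (P' ∩ X).card < P'.card := Finset.card_lt_card ⟨Finset.inter_subset_left, fun h => haX (Finset.mem_inter.1 (h ha)).2⟩
        rw [← heq] at this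
        omega
      rw [hPin, hP'in] at heq
      exact heq
    · -- P ∩ X = {a}; P = {a, r} with r ∈ R the unique mate of a
      rcases hP'X with ⟨hsub', hc'⟩ | ⟨hsub', hc'⟩
      · have hP'in : P' ∩ X = P' := by
          apply Finset.inter_eq_left.2
          intro a ha
          by_contra haX
          have : (P' ∩ X).card < P'.card := Finset.card_lt_card ⟨Finset.inter_subset_left, fun h => haX (Finset.mem_inter.1 (h ha)).2⟩
          omega
        rw [hP'in] at heq
        rw [heq] at hc
        omega
      · obtain ⟨a, ha⟩ := Finset.card_eq_one.1 hc
        have ha' : P' ∩ X = {a} := by rw [← heq, ha]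
        -- a ∈ P, a ∈ P'
        have haP : a ∈ P := (Finset.mem_inter.1 (ha ▸ Finset.mem_singleton_self a)).1
        have haP' : a ∈ P' := (Finset.mem_inter.1 (ha' ▸ Finset.mem_singleton_self a)).1
        have haX : a ∈ X := (Finset.mem_inter.1 (ha ▸ Finset.mem_singleton_self a)).2
        -- the other elements
        obtain ⟨x, y, hxy, hPxy⟩ := Finset.card_eq_two.1 hP2
        obtain ⟨x', y', hxy', hP'xy⟩ := Finset.card_eq_two.1 hP'2
        have hother : ∀ Q, Q.card = 2 → a ∈ Q → Q ∩ X = {a} → (∀ x ∈ Q, ∀ y ∈ Q, x ≠ y → SeriesPair M S u x y) →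
            Q ⊆ S → ∃ r, Q = {a, r} ∧ r ∈ R ∧ SeriesPair M S u a r := by
          intro Q hQ2 haQ hQX hQser hQS
          obtain ⟨x, y, hxy, rfl⟩ := Finset.card_eq_two.1 hQ2
          rw [Finset.mem_insert, Finset.mem_singleton] at haQ
          rcases haQ with rfl | rfl
          · refine ⟨y, rfl, ?_, hQser a (by simp) y (by simp) hxy⟩
            apply hout _ hQS hQ2 hQser y (by simp)
            intro hyX
            have : y ∈ ({a, y} : Finset α) ∩ X := Finset.mem_inter.2 ⟨by simp, hyX⟩
            rw [hQX, Finset.mem_singleton] at this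
            exact hxy this.symm
          · refine ⟨x, Finset.pair_comm x a, ?_, hQser a (by simp) x (by simp) hxy.symm⟩
            apply hout _ hQS hQ2 hQser x (by simp)
            intro hxX
            have : x ∈ ({x, a} : Finset α) ∩ X := Finset.mem_inter.2 ⟨by simp, hxX⟩
            rw [hQX, Finset.mem_singleton] at this
            exact hxy this
        obtain ⟨r, hPr, hrR, hpr⟩ := hother P hP2 haP ha hser hPS
        obtain ⟨r', hP'r, hr'R, hpr'⟩ := hother P' hP'2 haP' ha' hser' hP'S
        have : r = r' := huniq a (hXN haX) r hrR r' hr'R hpr hpr'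
        rw [hPr, hP'r, this]
  have hle : (seriesPairs M S u).card ≤ (Finset.powersetCard 2 X ∪ Finset.powersetCard 1 X).card :=
    Finset.card_le_card_of_injOn _ (fun P hP => hpairX P (Finset.mem_coe.1 hP)) hinj
  have hdisj : Disjoint (Finset.powersetCard 2 X) (Finset.powersetCard 1 X) := by
    rw [Finset.disjoint_left]
    intro P h1 h2
    rw [Finset.mem_powersetCard] at h1 h2
    omega
  rw [Finset.card_union_of_disjoint hdisj, Finset.card_powersetCard, Finset.card_powersetCard, Nat.choose_two_right,
    Nat.choose_one_right] at hle
  -- 2 * (C(n,2) + n) = n (n + 1) ≤ (u+2−a)(u+1−a) with n = |X| ≤ u + 1 − a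
  have hn : X.card ≤ u + 1 - (coloops M S).card := by omega
  have hx2 : 2 * (X.card * (X.card - 1) / 2 + X.card) ≤ X.card * (X.card + 1) := by
    have h2 : 2 ∣ X.card * (X.card - 1) := even_iff_two_dvd.1 (Nat.even_mul_pred_self X.card)
    have hmc : 2 * (X.card * (X.card - 1) / 2) = X.card * (X.card - 1) := Nat.mul_div_cancel' h2
    rcases Nat.eq_zero_or_pos X.card with h0 | hpos
    · simp [h0]
    · have h3 : X.card - 1 + 2 = X.card + 1 := by omega
      have hcalc : 2 * (X.card * (X.card - 1) / 2 + X.card) = X.card * (X.card + 1) := by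
        calc 2 * (X.card * (X.card - 1) / 2 + X.card) = 2 * (X.card * (X.card - 1) / 2) + 2 * X.card := by ring
          _ = X.card * (X.card - 1) + 2 * X.card := by rw [hmc]
          _ = X.card * (X.card - 1 + 2) := by ring
          _ = X.card * (X.card + 1) := by rw [h3]
      exact hcalc.le
  calc 2 * (seriesPairs M S u).card ≤ 2 * (X.card * (X.card - 1) / 2 + X.card) := by omega
    _ ≤ X.card * (X.card + 1) := hx2
    _ ≤ (u + 1 - (coloops M S).card) * (u + 2 - (coloops M S).card) := by
        apply Nat.mul_le_mul hn; omega
    _ = (u + 2 - (coloops M S).card) * (u + 1 - (coloops M S).card) := Nat.mul_comm _ _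


/-! ## The members carrying layer-2 weight are series pairs; THEOREM E -/

open scoped Classical in
/-- The complements `S ∖ B` of the members carrying layer-2 weight at `S` are series pairs of `S`. -/
theorem sdiff_mem_seriesPairs {q : ℕ} {G : Finset α} (hG : G ∈ flatsQ M (q + 1))
    {S : Finset α} (hS : S ∈ shadowAt M (q + 2) q (Uq M (q + 2) q) G) {B : Finset α}
    (hB : B ∈ ex2 M q G S) : S \ B ∈ seriesPairs M S q := by
  have hSG : S ⊆ G := subset_of_mem_shadowAt hS
  have hSE : S ⊆ gr M := hSG.trans (mem_flatsQ.1 hG).1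
  have hSr : rkN M S = q + 1 := by
    unfold rkN; rw [eRk_eq_of_mem_Yq_diag (mem_shadow.1 (mem_shadowAt.1 hS).1).1]; rfl
  unfold ex2 at hB
  rw [Finset.mem_filter] at hB
  obtain ⟨hBm, hw⟩ := hB
  have hBU : B ∈ Uq M (q + 2) q := (mem_membersIn.1 hBm).1
  have hBG : clF M B ⊆ G := (mem_membersIn.1 hBm).2
  unfold w2 at hw
  split_ifs at hw with hc
  · obtain ⟨hB0, hBS, hsub, hcard⟩ := hc
    unfold seriesPairs
    rw [Finset.mem_filter, Finset.mem_powersetCard]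
    refine ⟨⟨Finset.sdiff_subset, hcard⟩, ?_⟩
    intro x hx y hy hxy
    have hxS : x ∈ S := (Finset.mem_sdiff.1 hx).1
    have hyS : y ∈ S := (Finset.mem_sdiff.1 hy).1
    have hxB : x ∉ B := (Finset.mem_sdiff.1 hx).2
    have hyB : y ∉ B := (Finset.mem_sdiff.1 hy).2
    have hBr : rkN M B = q := by
      unfold rkN; rw [(mem_Uq.1 hBU).2.1]; rfl
    -- non-coloops: S.erase x ⊇ insert y B spans G
    have hnc : ∀ a b, a ∈ S \ B → b ∈ S \ B → a ≠ b → rkN M (S.erase a) = q + 1 := by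
      intro a b ha hb hab
      have hbG : b ∈ G \ clF M B := hsub hb
      have hcl : clF M (insert b B) = G := clF_insert_eq_of_mem_sdiff hG hBU hBG hbG
      have hrk : rkN M (insert b B) = q + 1 := by
        unfold rkN
        have : M.eRk ((insert b B : Finset α) : Set α) = M.eRk (G : Set α) := by
          rw [← M.eRk_closure_eq ((insert b B : Finset α) : Set α), ← coe_clF, hcl]
        rw [this, (mem_flatsQ.1 hG).2.2]; rfl
      have hsub' : insert b B ⊆ S.erase a := by
        intro e he
        rw [Finset.mem_insert] at he
        rw [Finset.mem_erase]
        rcases he with rfl | he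
        · exact ⟨fun h => hab h.symm, (Finset.mem_sdiff.1 hb).1⟩
        · exact ⟨fun h => (Finset.mem_sdiff.1 ha).2 (h ▸ he), hBS he⟩
      have h1 := rkN_mono (M := M) hsub'
      have h2 := rkN_mono (M := M) (Finset.erase_subset a S)
      rw [hrk] at h1; rw [hSr] at h2
      omega
    refine ⟨hxS, hyS, hxy, hnc x y hx hy hxy, hnc y x hy hx hxy.symm, ?_⟩
    have hpair : S \ {x, y} = B := by
      have hP : S \ B = {x, y} := by
        obtain ⟨x', y', hxy', hP⟩ := Finset.card_eq_two.1 hcard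
        rw [hP] at hx hy ⊢
        rw [Finset.mem_insert, Finset.mem_singleton] at hx hy
        rcases hx with rfl | rfl <;> rcases hy with rfl | rfl
        · exact absurd rfl hxy
        · rfl
        · exact Finset.pair_comm _ _
        · exact absurd rfl hxy
      rw [← hP, Finset.sdiff_sdiff_eq_self hBS]
    rw [hpair, hBr]
  · exact absurd rfl hw

open scoped Classical in
/-- **(k3)**: `2 · #ex2 S ≤ (q+2−κ₀(S))(q+1−κ₀(S))` at every shadow set. -/
theorem two_mul_card_ex2_le {q : ℕ} {G : Finset α} (hG : G ∈ flatsQ M (q + 1))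
    {S : Finset α} (hS : S ∈ shadowAt M (q + 2) q (Uq M (q + 2) q) G) :
    2 * (ex2 M q G S).card ≤ (q + 2 - (coloops M S).card) * (q + 1 - (coloops M S).card) := by
  have hSG : S ⊆ G := subset_of_mem_shadowAt hS
  have hSE : S ⊆ gr M := hSG.trans (mem_flatsQ.1 hG).1
  have hSr : rkN M S = q + 1 := by
    unfold rkN; rw [eRk_eq_of_mem_Yq_diag (mem_shadow.1 (mem_shadowAt.1 hS).1).1]; rfl
  have hinj : (ex2 M q G S).card ≤ (seriesPairs M S q).card := by
    apply Finset.card_le_card_of_injOn (fun B => S \ B)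
    · intro B hB
      exact sdiff_mem_seriesPairs hG hS (Finset.mem_coe.1 hB)
    · intro B hB B' hB' hBB'
      have hsub : ∀ C ∈ ex2 M q G S, C ⊆ S := by
        intro C hC
        unfold ex2 at hC
        rw [Finset.mem_filter] at hC
        exact subset_of_w2_ne hC.2
      have h1 := hsub B (Finset.mem_coe.1 hB)
      have h2 := hsub B' (Finset.mem_coe.1 hB')
      have h3 : S \ B = S \ B' := hBB'
      calc B = S \ (S \ B) := (Finset.sdiff_sdiff_eq_self h1).symm
        _ = S \ (S \ B') := by rw [h3]
        _ = B' := Finset.sdiff_sdiff_eq_self h2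
  calc 2 * (ex2 M q G S).card ≤ 2 * (seriesPairs M S q).card := by omega
    _ ≤ _ := two_mul_card_seriesPairs_le hSE hSr

open scoped Classical in
/-- **THEOREM E (kernel).**  At a rank-`(q+1)` flat `G` with `|E ∖ G| = q` whose restriction `M|G` has `k`
coloops with `2k ≤ (q+1−k)²`, the local form (LI_G) holds. -/
theorem localShadowHall_dq {q : ℕ} {G : Finset α} (hG : G ∈ flatsQ M (q + 1))
    (hd : (gr M \ G).card = q) (hk : 2 * kColoops M G ≤ (q + 1 - kColoops M G) ^ 2) :
    LocalShadowHall M q G :=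
  localShadowHall_dq_of_pairs hG hd hk (fun _ hS => two_mul_card_ex2_le hG hS)


end PercRepro.Shadow
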